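import Literature.MathematicalPhysics.QuantumFieldTheory.Balaban1983to89.Beta.BalabanStepJets
import Literature.MathematicalPhysics.QuantumFieldTheory.Balaban1983to89.Beta.ResolventComposition

/-!
# `BalabanUV.Beta.GAN24.KernelLegCharges` — row G-an2-4 ∕ (CONV-C), W-slot, SKELETON-W3 v0.2 §7.2 sum rule (S3c), PART 1a (generic bricks):
# DOUBLE-LEG SUMS OF BI-LOCALISED KERNELS, FUBINI FOR WEIGHTED SUPERPOSITIONS, THE FLAT WILSON HESSIAN COLUMN KILLS CONSTANTS,
# AND (Q-lin) FOR THE MULTIPLIER–FIELD ROW OF THE PACKED RESOLVENT ⇒ THE LAGRANGE COEFFICIENTS SUM TO ZERO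

NOT IN PRINT; OUR PROOF ATTEMPT (idle-seat one-shot kernel lemma under the row owner's RULINGS-13 invitation «W3-S3C*», unit
`b2b-balaban-gan24-formalise-leaf-06`, gen 8).  HONEST FRAMING (cell contract, verbatim): «discharging `BetaPertH` makes Bałaban's UV stability
UNCONDITIONAL — a real constructive-QFT result; it is NOT the continuum limit and NOT the Clay problem.»  HONEST DEPENDENCY (verbatim):
«continuum YM on T⁴ ⇐ BetaPertH ∧ nine spine estimates (0/9 proved); BetaPertH ⇐ (D1) ∧ (D4) ∧ CAP+tail; G-an2-4 gates asym, D1 and NE2/3/4.»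

WHAT ([folklore] analysis on `ℤ^{d+1}`; generic `d`, generic blocking `N ≥ 1`; 0 `def`, 0 cite, 0 sorry):
* §1 a bi-localised kernel (`ExpKernelCalculus.BiLoc`, rate `> 0`) is absolutely summable over BOTH legs; the double-leg sum in product ∕ iterated
  form; invariance under simultaneous shifts (`tsum_prod_shiftK`);
* §2 FUBINI for weighted superpositions `x z ↦ Σ'_y w y · Q y x z a b` (weights decaying from a fine point at the coarse scale `N`, kernels
  bi-localised at their own coarse point — the shape of `OneStepResolventKernel.wsum`∕`vertexOf` and of `InterLevelTransport.cwsum`∕`SLam`):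
  the double-leg sum is `Σ'_y w y · (double-leg sum of Q y)` (`hasSum_prod_wsum`); hence ZERO when every `Q y` has zero double-leg sum
  (`hasSum_prod_wsum_of_kernels`) or when the weights sum to zero and the `Q y` share one double-leg sum (`hasSum_prod_wsum_of_weights`);
* §3 the flat Wilson Hessian column `BalabanStepJets.elCol κ′ u` (= `curvAdj (curv e_{(κ′,u)})`) has ZERO TOTAL in every direction
  (`hasSum_elCol_zero`, `sum_box1_elCol_eq_zero`): `curvAdj` is a sum of lattice divergences;
* §4 (Q-lin) for the MULTIPLIER–FIELD ROW of the packed resolvent: `Σ'_y KInv (N•y) x (inr μ) (inl α) = −δ_{αμ}·N^{−(d+2)}` for EVERY fine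
  site `x` (`hasSum_KInv_inr_inl`: the row is `−wH α μ (x − N•y)` by `ResolventComposition.GamΦ_eq_neg_wH`, and the minimiser kernel reproduces
  constants, `KernelSpecInstance.lowMomentsSum_specK` (L0∞)); CONSEQUENCE: the Lagrange coefficients of the packed resolvent sum to zero over the
  coarse bond position, `Σ'_y lamCoeffOf (KInv N) N μ y κ′ u = 0` (`hasSum_lamCoeffOf_KInv`).
Consumed by PART 1b `GAN24/CompositeStencilChargeZero` (the composite fine stencil `Sc n` has zero field–field double-leg sums) and PART 2.
Asserts NO shape of Bałaban's tables, pins no colour constant, discharges NOTHING of «T2Shape»∕(hW, hWall).  NOT «W-slot closed», NEVER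
«G-an2-4 closed»; NOT BetaPertH, NOT continuum, NOT Clay.
-/

noncomputable section

open Finset
open scoped BigOperators
open Literature.MathematicalPhysics.QuantumFieldTheory
open Literature.MathematicalPhysics.QuantumFieldTheory.Balaban1983to89
open Literature.MathematicalPhysics.QuantumFieldTheory.Balaban1983to89.Beta
open B12Sec2to5 (l1 l1_nonneg Decay510 summable_exp_neg_l1)
open ExpKernelCalculus (Site MKer BiLoc Decays VertexFamily shiftK l1_natSmul l1_sub_triangle Zl summable_exp_shift summable_exp_shift'
  tsum_exp_shift')
open AffineAveraging (unitVec curvAdj curv Form2)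
open KernelSpecInstance (wH decay_wH lowMomentsSum_specK)
open KKTFluctuationKernel (GamΦ)
open ResolventComposition (GamΦ_eq_neg_wH)
open KernelRepresentationSummable (constReproSum_iff_decimated)
open KKTFluctuationEnergy (tsum_shift_sub summable_shift_sub)
open OneStepResolventKernel (Fib LocStencil KInv wsum vertexOf KInv_inr_inl_coarse decays_KInv)
open BalabanStepJets (box1 elCol elCol_eq_zero_of_not_mem_box1 bondDelta lamCoeffOf abs_lamCoeffOf_le)

namespace Summit.QuantumFields.BalabanUV.Beta.GAN24.KernelLegCharges

variable {d : ℕ}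

/-! ## §1 Double-leg sums of bi-localised kernels: summability, iterated form, shift invariance -/

/-- [folklore] A bi-localised kernel (rate `δ > 0`) is absolutely summable over BOTH legs. -/
theorem summable_prod_of_biLoc {K : MKer (d + 1) (Fib d)} {p q : Site (d + 1)} {C δ : ℝ} (hK : BiLoc K p q C δ) (hδ : 0 < δ)
    (a b : Fib d) : Summable fun xz : Site (d + 1) × Site (d + 1) => K xz.1 xz.2 a b := by
  have hC : 0 ≤ C := hK.nonneg a
  have h1 : Summable fun x : Site (d + 1) => Real.exp (-δ * l1 (x - p)) := summable_exp_shift' hδ p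
  have h2 : Summable fun z : Site (d + 1) => Real.exp (-δ * l1 (z - q)) := summable_exp_shift' hδ q
  have hprod : Summable fun xz : Site (d + 1) × Site (d + 1) =>
      C * (Real.exp (-δ * l1 (xz.1 - p)) * Real.exp (-δ * l1 (xz.2 - q))) :=
    (h1.mul_of_nonneg h2 (fun _ => (Real.exp_pos _).le) (fun _ => (Real.exp_pos _).le)).mul_left C
  refine Summable.of_norm_bounded hprod (fun xz => ?_)
  rw [Real.norm_eq_abs]
  refine (hK xz.1 xz.2 a b).trans (le_of_eq ?_)
  rw [mul_add, Real.exp_add]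

/-- [folklore] Slices of a bi-localised kernel are summable (second leg). -/
theorem summable_right_of_biLoc {K : MKer (d + 1) (Fib d)} {p q : Site (d + 1)} {C δ : ℝ} (hK : BiLoc K p q C δ) (hδ : 0 < δ)
    (a b : Fib d) (x : Site (d + 1)) : Summable fun z : Site (d + 1) => K x z a b :=
  (summable_prod_of_biLoc hK hδ a b).prod_factor x

/-- [folklore] The double-leg sum of a bi-localised kernel in iterated form. -/
theorem tsum_prod_eq_tsum_tsum_of_biLoc {K : MKer (d + 1) (Fib d)} {p q : Site (d + 1)} {C δ : ℝ} (hK : BiLoc K p q C δ)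
    (hδ : 0 < δ) (a b : Fib d) :
    ∑' xz : Site (d + 1) × Site (d + 1), K xz.1 xz.2 a b = ∑' x, ∑' z, K x z a b :=
  (summable_prod_of_biLoc hK hδ a b).tsum_prod

/-- [folklore] A bi-localised kernel whose ITERATED double-leg sum is `s` has the double-leg `HasSum` `s`. -/
theorem hasSum_prod_of_biLoc_of_tsum {K : MKer (d + 1) (Fib d)} {p q : Site (d + 1)} {C δ : ℝ} (hK : BiLoc K p q C δ)
    (hδ : 0 < δ) (a b : Fib d) {s : ℝ} (h : ∑' x, ∑' z, K x z a b = s) :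
    HasSum (fun xz : Site (d + 1) × Site (d + 1) => K xz.1 xz.2 a b) s := by
  rw [← h, ← tsum_prod_eq_tsum_tsum_of_biLoc hK hδ a b]
  exact (summable_prod_of_biLoc hK hδ a b).hasSum

/-- [folklore] The double-leg sum is invariant under a simultaneous shift of both legs. -/
theorem tsum_prod_shiftK (K : MKer (d + 1) (Fib d)) (v : Site (d + 1)) (a b : Fib d) :
    ∑' xz : Site (d + 1) × Site (d + 1), shiftK v K xz.1 xz.2 a b = ∑' xz : Site (d + 1) × Site (d + 1), K xz.1 xz.2 a b := by
  rw [← (Equiv.prodCongr (Equiv.addRight v) (Equiv.addRight v)).tsum_eq (fun xz : Site (d + 1) × Site (d + 1) => K xz.1 xz.2 a b)]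
  rfl

/-! ## §2 Weighted superpositions of kernel families: Fubini for `Σ'_y w y · Q y` against the double-leg sum -/

/-- [folklore] `Σ_y e^{−δ|N•y − u|₁}` converges for `N ≥ 1` (compare with `e^{δ|u|₁}·e^{−δ|y|₁}`). -/
theorem summable_exp_coarse {N : ℕ} (hN : 1 ≤ N) {δ : ℝ} (hδ : 0 < δ) (u : Site (d + 1)) :
    Summable fun y : Site (d + 1) => Real.exp (-δ * l1 ((N : ℤ) • y - u)) := by
  refine Summable.of_norm_bounded ((summable_exp_neg_l1 hδ (d + 1)).mul_left (Real.exp (δ * l1 u))) (fun y => ?_)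
  rw [Real.norm_eq_abs, abs_of_pos (Real.exp_pos _), ← Real.exp_add, Real.exp_le_exp]
  have h1 : l1 ((N : ℤ) • y - 0) ≤ l1 ((N : ℤ) • y - u) + l1 (u - 0) := l1_sub_triangle _ _ _
  rw [sub_zero, sub_zero, l1_natSmul] at h1
  have h2 : l1 y ≤ (N : ℝ) * l1 y := le_mul_of_one_le_left (l1_nonneg y) (by exact_mod_cast hN)
  nlinarith

/-- [folklore] **ABSOLUTE SUMMABILITY OF THE WEIGHTED TRIPLE FAMILY** `(y, x, z) ↦ w y · Q y x z a b`: weights decaying from `u` at the coarse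
scale `N ≥ 1` (`|w y| ≤ C e^{−δ|N•y − u|₁}`) and kernels bi-localised at their own coarse point `N•y` (one constant, rate `δq > 0`). -/
theorem summable_weight_mul_kernel {N : ℕ} (hN : 1 ≤ N) {w : Site (d + 1) → ℝ} {Q : Site (d + 1) → MKer (d + 1) (Fib d)}
    {C δ Cq δq : ℝ} {u : Site (d + 1)} (hw : ∀ y, |w y| ≤ C * Real.exp (-δ * l1 ((N : ℤ) • y - u))) (hδ : 0 < δ)
    (hQ : ∀ y, BiLoc (Q y) ((N : ℤ) • y) ((N : ℤ) • y) Cq δq) (hδq : 0 < δq) (a b : Fib d) :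
    Summable fun s : Site (d + 1) × (Site (d + 1) × Site (d + 1)) => w s.1 * Q s.1 s.2.1 s.2.2 a b := by
  have hCq : 0 ≤ Cq := (hQ 0).nonneg a
  have hC : 0 ≤ C := by
    have h := hw 0
    have he := Real.exp_pos (-δ * l1 ((N : ℤ) • (0 : Site (d + 1)) - u))
    by_contra hC
    have := mul_neg_of_neg_of_pos (lt_of_not_ge hC) he
    linarith [abs_nonneg (w 0)]
  -- the majorant
  set g : Site (d + 1) × (Site (d + 1) × Site (d + 1)) → ℝ := fun s =>
    (C * Real.exp (-δ * l1 ((N : ℤ) • s.1 - u))) *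
      (Cq * (Real.exp (-δq * l1 (s.2.1 - (N : ℤ) • s.1)) * Real.exp (-δq * l1 (s.2.2 - (N : ℤ) • s.1)))) with hg
  have hg0 : 0 ≤ g := fun s => by positivity
  have hinner : ∀ y : Site (d + 1), HasSum (fun xz : Site (d + 1) × Site (d + 1) => g (y, xz))
      ((C * Real.exp (-δ * l1 ((N : ℤ) • y - u))) * (Cq * (Zl (d + 1) δq * Zl (d + 1) δq))) := by
    intro y
    have hx : HasSum (fun x : Site (d + 1) => Real.exp (-δq * l1 (x - (N : ℤ) • y))) (Zl (d + 1) δq) := by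
      rw [← tsum_exp_shift' ((N : ℤ) • y)]
      exact (summable_exp_shift' hδq _).hasSum
    have hxz := hx.mul hx (hx.summable.mul_of_nonneg hx.summable (fun _ => (Real.exp_pos _).le) (fun _ => (Real.exp_pos _).le))
    exact (hxz.mul_left Cq).mul_left _
  have hgs : Summable g := by
    refine (summable_prod_of_nonneg hg0).2 ⟨fun y => (hinner y).summable, ?_⟩
    have e : (fun y : Site (d + 1) => ∑' xz : Site (d + 1) × Site (d + 1), g (y, xz)) =
        fun y => (C * (Cq * (Zl (d + 1) δq * Zl (d + 1) δq))) * Real.exp (-δ * l1 ((N : ℤ) • y - u)) := by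
      funext y
      rw [(hinner y).tsum_eq]
      ring
    rw [e]
    exact (summable_exp_coarse hN hδ u).mul_left _
  refine Summable.of_norm_bounded hgs (fun s => ?_)
  rw [Real.norm_eq_abs, abs_mul, hg]
  have h1 := hw s.1
  have h2 := hQ s.1 s.2.1 s.2.2 a b
  calc |w s.1| * |Q s.1 s.2.1 s.2.2 a b|
      ≤ (C * Real.exp (-δ * l1 ((N : ℤ) • s.1 - u))) * (Cq * Real.exp (-δq * (l1 (s.2.1 - (N : ℤ) • s.1) + l1 (s.2.2 - (N : ℤ) • s.1)))) :=
        mul_le_mul h1 h2 (abs_nonneg _) ((abs_nonneg _).trans h1)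
    _ = _ := by rw [mul_add, Real.exp_add]

/-- [folklore] **FUBINI FOR THE WEIGHTED SUPERPOSITION**: under the hypotheses of `summable_weight_mul_kernel`, the double-leg family of
`x z ↦ Σ'_y w y · Q y x z a b` is summable and its sum is `Σ'_y w y · (Σ'_{(x,z)} Q y x z a b)`. -/
theorem hasSum_prod_wsum {N : ℕ} (hN : 1 ≤ N) {w : Site (d + 1) → ℝ} {Q : Site (d + 1) → MKer (d + 1) (Fib d)}
    {C δ Cq δq : ℝ} {u : Site (d + 1)} (hw : ∀ y, |w y| ≤ C * Real.exp (-δ * l1 ((N : ℤ) • y - u))) (hδ : 0 < δ)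
    (hQ : ∀ y, BiLoc (Q y) ((N : ℤ) • y) ((N : ℤ) • y) Cq δq) (hδq : 0 < δq) (a b : Fib d) :
    HasSum (fun xz : Site (d + 1) × Site (d + 1) => ∑' y, w y * Q y xz.1 xz.2 a b)
      (∑' y, w y * ∑' xz : Site (d + 1) × Site (d + 1), Q y xz.1 xz.2 a b) := by
  have hs : Summable (Function.uncurry fun (y : Site (d + 1)) (xz : Site (d + 1) × Site (d + 1)) => w y * Q y xz.1 xz.2 a b) :=
    summable_weight_mul_kernel hN hw hδ hQ hδq a b
  -- summability in `xz` of the `y`-sums: the swapped family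
  have hsw : Summable fun s : (Site (d + 1) × Site (d + 1)) × Site (d + 1) => w s.2 * Q s.2 s.1.1 s.1.2 a b := hs.prod_symm
  have h1 : Summable fun xz : Site (d + 1) × Site (d + 1) => ∑' y, w y * Q y xz.1 xz.2 a b := hsw.prod
  have h2 : ∑' (xz : Site (d + 1) × Site (d + 1)) (y : Site (d + 1)), w y * Q y xz.1 xz.2 a b
      = ∑' (y : Site (d + 1)) (xz : Site (d + 1) × Site (d + 1)), w y * Q y xz.1 xz.2 a b := hs.tsum_comm
  have hval : ∑' (xz : Site (d + 1) × Site (d + 1)) (y : Site (d + 1)), w y * Q y xz.1 xz.2 a b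
      = ∑' y, w y * ∑' xz : Site (d + 1) × Site (d + 1), Q y xz.1 xz.2 a b := by
    rw [h2]
    exact tsum_congr fun y => tsum_mul_left
  rw [← hval]
  exact h1.hasSum

/-- [folklore] **KERNELS WITH ZERO DOUBLE-LEG SUM**: if every `Q y` has zero double-leg sum, so has the superposition `Σ'_y w y · Q y`. -/
theorem hasSum_prod_wsum_of_kernels {N : ℕ} (hN : 1 ≤ N) {w : Site (d + 1) → ℝ} {Q : Site (d + 1) → MKer (d + 1) (Fib d)}
    {C δ Cq δq : ℝ} {u : Site (d + 1)} (hw : ∀ y, |w y| ≤ C * Real.exp (-δ * l1 ((N : ℤ) • y - u))) (hδ : 0 < δ)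
    (hQ : ∀ y, BiLoc (Q y) ((N : ℤ) • y) ((N : ℤ) • y) Cq δq) (hδq : 0 < δq) (a b : Fib d)
    (h0 : ∀ y, ∑' xz : Site (d + 1) × Site (d + 1), Q y xz.1 xz.2 a b = 0) :
    HasSum (fun xz : Site (d + 1) × Site (d + 1) => ∑' y, w y * Q y xz.1 xz.2 a b) 0 := by
  have h := hasSum_prod_wsum hN hw hδ hQ hδq a b
  simp_rw [h0, mul_zero, tsum_zero] at h
  exact h

/-- [folklore] **WEIGHTS WITH ZERO SUM AGAINST SHIFT-COPIES**: if the weights sum to zero and every `Q y` has the SAME double-leg sum (e.g. the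
`Q y` are simultaneous-shift copies of `Q 0`), the superposition has zero double-leg sum. -/
theorem hasSum_prod_wsum_of_weights {N : ℕ} (hN : 1 ≤ N) {w : Site (d + 1) → ℝ} {Q : Site (d + 1) → MKer (d + 1) (Fib d)}
    {C δ Cq δq : ℝ} {u : Site (d + 1)} (hw : ∀ y, |w y| ≤ C * Real.exp (-δ * l1 ((N : ℤ) • y - u))) (hδ : 0 < δ)
    (hQ : ∀ y, BiLoc (Q y) ((N : ℤ) • y) ((N : ℤ) • y) Cq δq) (hδq : 0 < δq) (a b : Fib d) (hw0 : HasSum w 0)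
    (hT : ∀ y, ∑' xz : Site (d + 1) × Site (d + 1), Q y xz.1 xz.2 a b = ∑' xz : Site (d + 1) × Site (d + 1), Q 0 xz.1 xz.2 a b) :
    HasSum (fun xz : Site (d + 1) × Site (d + 1) => ∑' y, w y * Q y xz.1 xz.2 a b) 0 := by
  have h := hasSum_prod_wsum hN hw hδ hQ hδq a b
  simp_rw [hT] at h
  rw [tsum_mul_right, hw0.tsum_eq, zero_mul] at h
  exact h

/-! ## §3 The flat Wilson Hessian column kills constants -/

section ElCol

variable {D : ℕ}

/-- [folklore] A summable lattice function minus its translate sums to zero. -/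
theorem hasSum_sub_shift_zero {f : Site D → ℝ} (hf : Summable f) (v : Site D) : HasSum (fun x => f x - f (x - v)) 0 := by
  have h2 : HasSum (fun x => f (x - v)) (∑' x, f x) := by
    rw [← tsum_shift_sub f v]
    exact (summable_shift_sub hf v).hasSum
  simpa using hf.hasSum.sub h2

/-- [folklore] `curvAdj` of a 2-form with summable entries has zero total in every direction (it is a sum of lattice divergences). -/
theorem hasSum_curvAdj_zero (F : Form2 D ℝ) (hF : ∀ κ l, Summable fun x => F κ l x) (μ : Fin D) :
    HasSum (fun x => curvAdj F μ x) 0 := by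
  have h1 : HasSum (fun y : Site D => ∑ l, (F μ l y - F μ l (y - unitVec l))) (∑ l : Fin D, (0 : ℝ)) :=
    hasSum_sum fun l _ => hasSum_sub_shift_zero (hF μ l) (unitVec l)
  have h2 : HasSum (fun y : Site D => ∑ κ, (F κ μ (y - unitVec κ) - F κ μ y)) (∑ κ : Fin D, -(0 : ℝ)) :=
    hasSum_sum fun κ _ => by
      have h := (hasSum_sub_shift_zero (hF κ μ) (unitVec κ)).neg
      refine h.congr_fun fun y => ?_
      ring
  have h := h1.add h2
  simp only [Finset.sum_const_zero, neg_zero, add_zero] at h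
  exact h

/-- [folklore] A translated Kronecker delta on `ℤ^D` is summable. -/
theorem summable_bondDelta_shift (κ' l : Fin D) (u v : Site D) : Summable fun x : Site D => bondDelta κ' u l (x + v) := by
  refine summable_of_ne_finset_zero (s := {u - v}) (fun x hx => ?_)
  rw [Finset.mem_singleton] at hx
  simp only [bondDelta]
  rw [if_neg]
  rintro ⟨-, h⟩
  exact hx (by rw [← h]; abel)

/-- [folklore] The curvature of a Kronecker delta has summable entries. -/
theorem summable_curv_bondDelta (κ' : Fin D) (u : Site D) (κ l : Fin D) : Summable fun x : Site D => curv (bondDelta κ' u) κ l x := by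
  have h0 := summable_bondDelta_shift κ' κ u (0 : Site D)
  have h0' := summable_bondDelta_shift κ' l u (0 : Site D)
  simp only [add_zero] at h0 h0'
  have h1 := summable_bondDelta_shift κ' l u (unitVec κ)
  have h2 := summable_bondDelta_shift κ' κ u (unitVec l)
  simpa only [curv] using ((h0.add h1).sub h2).sub h0'

/-- [folklore] **THE FLAT WILSON HESSIAN COLUMN KILLS CONSTANTS**: `Σ'_x elCol κ′ u μ x = 0` (every column of `d*d` has zero total). -/
theorem hasSum_elCol_zero (κ' : Fin D) (u : Site D) (μ : Fin D) : HasSum (fun x => elCol κ' u μ x) 0 :=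
  hasSum_curvAdj_zero _ (summable_curv_bondDelta κ' u) μ

/-- [folklore] … in the finite form over the support box `u + {−1,0,1}^D`: `Σ_{v ∈ box1} elCol κ′ u μ (u + v) = 0`. -/
theorem sum_box1_elCol_eq_zero (κ' : Fin D) (u : Site D) (μ : Fin D) : ∑ v ∈ box1 D, elCol κ' u μ (u + v) = 0 := by
  have h := (hasSum_elCol_zero κ' u μ).tsum_eq
  rw [tsum_eq_sum (s := (box1 D).image fun v => u + v) (fun x hx => ?_)] at h
  · rwa [Finset.sum_image (fun v _ w _ h => add_left_cancel h)] at h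
  · have hv : x - u ∉ box1 D := fun hmem => hx (Finset.mem_image.2 ⟨x - u, hmem, by abel⟩)
    have := elCol_eq_zero_of_not_mem_box1 (κ' := κ') (u := u) (α := μ) hv
    rwa [show u + (x - u) = x by abel] at this

end ElCol

/-! ## §4 (Q-lin) for the multiplier–field row of the packed resolvent, and the zero sum of the Lagrange coefficients -/

section Resolvent

variable {N : ℕ} [NeZero N]

/-- [folklore] **THE MULTIPLIER–FIELD ROW OF `KInv` HAS A SITE-FREE COSET CHARGE**: for every fine site `x`,
`Σ'_y KInv (N•y) x (inr μ) (inl α) = −δ_{αμ} · N^{−(d+2)}` — the row is `−wH α μ (x − N•y)` (`GamΦ_eq_neg_wH`) and the minimiser kernel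
reproduces constants (`lowMomentsSum_specK`, (L0∞)). -/
theorem hasSum_KInv_inr_inl (μ α : Fin (d + 1)) (x : Site (d + 1)) :
    HasSum (fun y : Site (d + 1) => KInv (N := N) (d := d) ((N : ℤ) • y) x (Sum.inr μ) (Sum.inl α))
      (-(if α = μ then (((N : ℕ) : ℝ) ^ (d + 1 + 1))⁻¹ else 0)) := by
  have h := (constReproSum_iff_decimated (NeZero.ne N) (wH (N := N) α μ) _).1 ((lowMomentsSum_specK (N := N) (d := d)).1 α μ) x
  refine h.neg.congr_fun fun y => ?_
  rw [KInv_inr_inl_coarse, GamΦ_eq_neg_wH]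

/-- [folklore] The row family is summable. -/
theorem summable_KInv_inr_inl (μ α : Fin (d + 1)) (x : Site (d + 1)) :
    Summable fun y : Site (d + 1) => KInv (N := N) (d := d) ((N : ℤ) • y) x (Sum.inr μ) (Sum.inl α) :=
  (hasSum_KInv_inr_inl μ α x).summable

/-- [folklore] **THE LAGRANGE COEFFICIENTS OF THE PACKED RESOLVENT SUM TO ZERO OVER THE COARSE BOND POSITION**:
`Σ'_y lamCoeffOf (KInv N) N μ y κ′ u = 0` for every blocking `N ≥ 1` — site-free charge × zero total of the Hessian column. -/
theorem hasSum_lamCoeffOf_KInv (μ κ' : Fin (d + 1)) (u : Site (d + 1)) :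
    HasSum (fun y : Site (d + 1) => lamCoeffOf (KInv (N := N) (d := d)) N μ y κ' u) 0 := by
  set σ : ℝ := (((N : ℕ) : ℝ) ^ (d + 1 + 1))⁻¹ with hσ
  have h : HasSum (fun y : Site (d + 1) => lamCoeffOf (KInv (N := N) (d := d)) N μ y κ' u)
      (∑ v ∈ box1 (d + 1), ∑ α : Fin (d + 1), -(if α = μ then σ else 0) * elCol κ' u α (u + v)) := by
    unfold lamCoeffOf
    exact hasSum_sum fun v _ => hasSum_sum fun α _ => (hasSum_KInv_inr_inl μ α (u + v)).mul_right _
  have hval : ∑ v ∈ box1 (d + 1), ∑ α : Fin (d + 1), -(if α = μ then σ else 0) * elCol κ' u α (u + v) = 0 := by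
    have inner : ∀ v, ∑ α : Fin (d + 1), -(if α = μ then σ else 0) * elCol κ' u α (u + v) = -σ * elCol κ' u μ (u + v) := by
      intro v
      rw [Finset.sum_eq_single μ]
      · rw [if_pos rfl]
      · intro α _ hne
        rw [if_neg hne, neg_zero, zero_mul]
      · intro hμ
        exact absurd (Finset.mem_univ μ) hμ
    simp_rw [inner]
    rw [← Finset.mul_sum, sum_box1_elCol_eq_zero, mul_zero]
  rwa [hval] at h

end Resolvent

end Summit.QuantumFields.BalabanUV.Beta.GAN24.KernelLegCharges

end
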